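import Summits.AtomisticToContinuum.Crystallization.Theorems.PalmUnimodularRigidityLayeredLawsSelectHcpMassTransport

/-!
# Crux `LayeredLawsSelectHcp` (stmt-AtomisticToContinuum-9226), line `mtp-prestress-split-ergodic-frame`:
# the Mecke identity for SIGNED transport functions (Bochner form)

Registered sub-goal `tube_meckeIntegral` of the crux item (lead c2, cycle 3).  The certificate architecture for the
rigidity stub (`Cruxes/LayeredLawsSelectHcp/LeadC2Architecture.md`) proves the law-level floor as a pointwise inequality
modulo CORRECTORS `Γ(μ) = ∑_y [F(μ, y) − F(θ_y μ, −y)]` with `F` signed (first-order Gram functionals change sign).  Their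
mean vanishes by the crux's Mecke identity `PointStationary`, which is stated for `ℝ≥0∞`-valued transport functions; this
file supplies the Bochner (real, signed) form: for a point-stationary law `P` carried by locally finite configurations and
a jointly measurable `g : Measure ℝ³ → ℝ³ → ℝ` with `∫⁻∫⁻ ‖g μ y‖ₑ dμ dP < ∞`,

  `∫ μ, ∫ y, g μ y ∂μ ∂P = ∫ μ, ∫ y, g (θ_y μ) (−y) ∂μ ∂P`.

Proof: positive/negative parts through the `ℝ≥0∞` identity; all Campbell-type measurability (`μ ↦ ∫⁻ y, · ∂μ` with the
integrating measure equal to the variable) goes through the s-finite modification `κ` of the identity kernel on locally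
finite configurations (`exists_isSFiniteKernel_apply_eq_self`), as in `tube_pointShift_invariance` / `tube_weightedTransport`.
[cite: LastPenrose2017, Theorem 9.4; HevelingLast2005, §3]
-/

noncomputable section

open MeasureTheory ProbabilityTheory Set
open scoped ENNReal

namespace Summit.AtomisticToContinuum.Crystallization.Theorems.PalmUnimodularRigidity.LayeredLawsSelectHcp

open Summit.AtomisticToContinuum.Crystallization.Theorems.LayeredLawsSelectHcp.Negative.DiracLaws (PointStationary)
open Summit.AtomisticToContinuum.Crystallization.Theorems.PalmUnimodularRigidity
  (exists_isSFiniteKernel_apply_eq_self measurable_map_sub_kernel measurableSet_floorNorm_preimage)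

/-- **Bochner double integral through an s-finite kernel = difference of the two `ℝ≥0∞` double integrals of the
positive and negative parts**, when `∫⁻∫⁻ ‖G‖ₑ < ∞`. [folklore] -/
theorem integral_integral_kernel_eq_toReal_sub
    (κ : Kernel (Measure (EuclideanSpace ℝ (Fin 3))) (EuclideanSpace ℝ (Fin 3))) [IsSFiniteKernel κ]
    (P : Measure (Measure (EuclideanSpace ℝ (Fin 3))))
    {G : Measure (EuclideanSpace ℝ (Fin 3)) → EuclideanSpace ℝ (Fin 3) → ℝ} (hG : Measurable (Function.uncurry G))
    (hfin : ∫⁻ μ, ∫⁻ y, ‖G μ y‖ₑ ∂(κ μ) ∂P ≠ ⊤) :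
    ∫ μ, ∫ y, G μ y ∂(κ μ) ∂P =
      (∫⁻ μ, ∫⁻ y, ENNReal.ofReal (G μ y) ∂(κ μ) ∂P).toReal -
        (∫⁻ μ, ∫⁻ y, ENNReal.ofReal (-G μ y) ∂(κ μ) ∂P).toReal := by
  -- measurability of the three Campbell functionals through the kernel
  have hGp : Measurable (Function.uncurry fun μ y => ENNReal.ofReal (G μ y)) := hG.ennreal_ofReal
  have hGm : Measurable (Function.uncurry fun μ y => ENNReal.ofReal (-G μ y)) := hG.neg.ennreal_ofReal
  have hGe : Measurable (Function.uncurry fun μ y => ‖G μ y‖ₑ) := hG.enorm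
  have hA : Measurable fun μ => ∫⁻ y, ENNReal.ofReal (G μ y) ∂(κ μ) := hGp.lintegral_kernel_prod_right
  have hB : Measurable fun μ => ∫⁻ y, ENNReal.ofReal (-G μ y) ∂(κ μ) := hGm.lintegral_kernel_prod_right
  have hN : Measurable fun μ => ∫⁻ y, ‖G μ y‖ₑ ∂(κ μ) := hGe.lintegral_kernel_prod_right
  -- domination of the parts by the norm
  have hp_le : ∀ μ y, ENNReal.ofReal (G μ y) ≤ ‖G μ y‖ₑ := fun μ y => by
    rw [Real.enorm_eq_ofReal_abs]; exact ENNReal.ofReal_le_ofReal (le_abs_self _)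
  have hm_le : ∀ μ y, ENNReal.ofReal (-G μ y) ≤ ‖G μ y‖ₑ := fun μ y => by
    rw [Real.enorm_eq_ofReal_abs]; exact ENNReal.ofReal_le_ofReal (neg_le_abs _)
  have hAfin : ∫⁻ μ, ∫⁻ y, ENNReal.ofReal (G μ y) ∂(κ μ) ∂P ≠ ⊤ :=
    ne_top_of_le_ne_top hfin (lintegral_mono fun μ => lintegral_mono fun y => hp_le μ y)
  have hBfin : ∫⁻ μ, ∫⁻ y, ENNReal.ofReal (-G μ y) ∂(κ μ) ∂P ≠ ⊤ :=
    ne_top_of_le_ne_top hfin (lintegral_mono fun μ => lintegral_mono fun y => hm_le μ y)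
  -- a.e. the inner function is integrable, and the inner Bochner integral splits
  have hinner : ∀ᵐ μ ∂P, ∫ y, G μ y ∂(κ μ) =
      (∫⁻ y, ENNReal.ofReal (G μ y) ∂(κ μ)).toReal - (∫⁻ y, ENNReal.ofReal (-G μ y) ∂(κ μ)).toReal := by
    filter_upwards [ae_lt_top hN hfin] with μ hμ
    have hint : Integrable (G μ) (κ μ) :=
      ⟨(hG.of_uncurry_left).aestronglyMeasurable, hμ⟩
    exact integral_eq_lintegral_pos_part_sub_lintegral_neg_part hint
  rw [integral_congr_ae hinner, integral_sub (integrable_toReal_of_lintegral_ne_top hA.aemeasurable hAfin)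
    (integrable_toReal_of_lintegral_ne_top hB.aemeasurable hBfin),
    integral_toReal hA.aemeasurable (ae_lt_top hA hAfin), integral_toReal hB.aemeasurable (ae_lt_top hB hBfin)]

/-- **Registered sub-goal `tube_meckeIntegral` — the Mecke identity for signed transport functions.**  For a law `P`
on configurations satisfying the crux's Mecke identity (`PointStationary`, `−y` convention), almost surely locally finite,
and a jointly measurable `g : Measure ℝ³ → ℝ³ → ℝ` with `∫⁻ μ, ∫⁻ y, ‖g μ y‖ₑ ∂μ ∂P ≠ ⊤`:
`∫ μ, ∫ y, g μ y ∂μ ∂P = ∫ μ, ∫ y, g (θ_y μ) (−y) ∂μ ∂P`.  [cite: LastPenrose2017, Theorem 9.4] -/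
theorem tube_meckeIntegral :
    ∀ P : Measure (Measure (EuclideanSpace ℝ (Fin 3))), PointStationary P →
      (∀ᵐ μ ∂P, ∀ n : ℕ, μ ((fun z : (EuclideanSpace ℝ (Fin 3)) => ⌊‖z‖⌋₊) ⁻¹' {n}) < ⊤) →
      ∀ g : Measure (EuclideanSpace ℝ (Fin 3)) → (EuclideanSpace ℝ (Fin 3)) → ℝ, Measurable (Function.uncurry g) →
        (∫⁻ μ, ∫⁻ y, ‖g μ y‖ₑ ∂μ ∂P ≠ ⊤) →
          ∫ μ, ∫ y, g μ y ∂μ ∂P = ∫ μ, ∫ y, g (Measure.map (fun z => z - y) μ) (-y) ∂μ ∂P := by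
  intro P hstat hlf g hg hfin
  obtain ⟨κ, hκ, hκid⟩ := exists_isSFiniteKernel_apply_eq_self
    (fun n : ℕ => (fun z : (EuclideanSpace ℝ (Fin 3)) => ⌊‖z‖⌋₊) ⁻¹' {n}) measurableSet_floorNorm_preimage
    (fun i j hij => Set.disjoint_iff.2 fun z hz => hij (hz.1.symm.trans hz.2))
    (fun z => ⟨⌊‖z‖⌋₊, rfl⟩)
  -- the transported function, made measurable through the kernel
  set gt : Measure (EuclideanSpace ℝ (Fin 3)) → (EuclideanSpace ℝ (Fin 3)) → ℝ :=
    fun μ y => g ((κ μ).map (fun z => z - y)) (-y) with hgt_def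
  have hgt : Measurable (Function.uncurry gt) := by
    have : Function.uncurry gt = fun p : Measure (EuclideanSpace ℝ (Fin 3)) × (EuclideanSpace ℝ (Fin 3)) =>
        g ((κ p.1).map (fun z => z - p.2)) (-p.2) := by funext p; rfl
    rw [this]
    exact hg.comp ((measurable_map_sub_kernel κ).prodMk measurable_snd.neg)
  have hgt_eq : ∀ᵐ μ ∂P, ∀ y, gt μ y = g (Measure.map (fun z => z - y) μ) (-y) := by
    filter_upwards [hlf] with μ hμ
    intro y
    simp only [hgt_def, hκid μ hμ]
  -- (1) the two ℝ≥0∞ Mecke identities (positive and negative parts), written through the kernel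
  have mecke : ∀ φ : ℝ → ℝ≥0∞, Measurable φ →
      ∫⁻ μ, ∫⁻ y, φ (g μ y) ∂(κ μ) ∂P = ∫⁻ μ, ∫⁻ y, φ (gt μ y) ∂(κ μ) ∂P := by
    intro φ hφ
    have h := hstat (fun μ y => φ (g μ y)) (hφ.comp hg)
    have hl : ∫⁻ μ, ∫⁻ y, φ (g μ y) ∂μ ∂P = ∫⁻ μ, ∫⁻ y, φ (g μ y) ∂(κ μ) ∂P := by
      refine lintegral_congr_ae ?_
      filter_upwards [hlf] with μ hμ
      rw [hκid μ hμ]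
    have hr : ∫⁻ μ, ∫⁻ y, φ (g (Measure.map (fun z => z - y) μ) (-y)) ∂μ ∂P =
        ∫⁻ μ, ∫⁻ y, φ (gt μ y) ∂(κ μ) ∂P := by
      refine lintegral_congr_ae ?_
      filter_upwards [hlf, hgt_eq] with μ hμ hμt
      rw [hκid μ hμ]
      exact lintegral_congr fun y => by rw [hμt y]
    rw [← hl, h, hr]
  -- (2) finiteness through the kernel, for g and for gt
  have hfin_g : ∫⁻ μ, ∫⁻ y, ‖g μ y‖ₑ ∂(κ μ) ∂P ≠ ⊤ := by
    have : ∫⁻ μ, ∫⁻ y, ‖g μ y‖ₑ ∂(κ μ) ∂P = ∫⁻ μ, ∫⁻ y, ‖g μ y‖ₑ ∂μ ∂P := by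
      refine lintegral_congr_ae ?_
      filter_upwards [hlf] with μ hμ
      rw [hκid μ hμ]
    rwa [this]
  have hfin_gt : ∫⁻ μ, ∫⁻ y, ‖gt μ y‖ₑ ∂(κ μ) ∂P ≠ ⊤ := by
    have h := mecke (fun r => ‖r‖ₑ) measurable_enorm
    rwa [← h]
  -- (3) Bochner forms through the kernel
  have hL := integral_integral_kernel_eq_toReal_sub κ P hg hfin_g
  have hR := integral_integral_kernel_eq_toReal_sub κ P hgt hfin_gt
  have hp := mecke (fun r => ENNReal.ofReal r) ENNReal.measurable_ofReal
  have hm := mecke (fun r => ENNReal.ofReal (-r)) (ENNReal.measurable_ofReal.comp measurable_neg)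
  -- (4) back from the kernel to `μ` on both sides
  have hL' : ∫ μ, ∫ y, g μ y ∂μ ∂P = ∫ μ, ∫ y, g μ y ∂(κ μ) ∂P := by
    refine integral_congr_ae ?_
    filter_upwards [hlf] with μ hμ
    rw [hκid μ hμ]
  have hR' : ∫ μ, ∫ y, g (Measure.map (fun z => z - y) μ) (-y) ∂μ ∂P = ∫ μ, ∫ y, gt μ y ∂(κ μ) ∂P := by
    refine integral_congr_ae ?_
    filter_upwards [hlf, hgt_eq] with μ hμ hμt
    rw [hκid μ hμ]
    exact integral_congr_ae (Filter.Eventually.of_forall fun y => (hμt y).symm)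
  rw [hL', hR', hL, hR, hp, hm]

/-- **Zero-mean correctors** (the form the certificate uses): under the hypotheses of `tube_meckeIntegral`, if in addition
the double Bochner integral splits (both one-sided transports `P`-integrable as functions of `μ`), then
`E[ ∫ (g μ y − g (θ_y μ) (−y)) dμ(y) ] = 0`. [cite: LastPenrose2017, Theorem 9.4] -/
theorem tube_corrector_mean_zero {P : Measure (Measure (EuclideanSpace ℝ (Fin 3)))} (hstat : PointStationary P)
    (hlf : ∀ᵐ μ ∂P, ∀ n : ℕ, μ ((fun z : (EuclideanSpace ℝ (Fin 3)) => ⌊‖z‖⌋₊) ⁻¹' {n}) < ⊤)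
    {g : Measure (EuclideanSpace ℝ (Fin 3)) → (EuclideanSpace ℝ (Fin 3)) → ℝ} (hg : Measurable (Function.uncurry g))
    (hfin : ∫⁻ μ, ∫⁻ y, ‖g μ y‖ₑ ∂μ ∂P ≠ ⊤)
    (h1 : Integrable (fun μ => ∫ y, g μ y ∂μ) P)
    (h2 : Integrable (fun μ => ∫ y, g (Measure.map (fun z => z - y) μ) (-y) ∂μ) P)
    (hsplit : ∀ᵐ μ ∂P, ∫ y, (g μ y - g (Measure.map (fun z => z - y) μ) (-y)) ∂μ =
      ∫ y, g μ y ∂μ - ∫ y, g (Measure.map (fun z => z - y) μ) (-y) ∂μ) :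
    ∫ μ, ∫ y, (g μ y - g (Measure.map (fun z => z - y) μ) (-y)) ∂μ ∂P = 0 := by
  rw [integral_congr_ae hsplit, integral_sub h1 h2, tube_meckeIntegral P hstat hlf g hg hfin, sub_self]

end Summit.AtomisticToContinuum.Crystallization.Theorems.PalmUnimodularRigidity.LayeredLawsSelectHcp

end
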